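import Mathlib
import HarnessLib
import Literature.Probability.Process.RootedHardCoreVague
import Summits.AtomisticToContinuum.Crystallization.Theorems.PalmUnimodularRigidityBenjaminiSchrammLimitEnergy

/-!
# Ergodic reduction for the crux `AperiodicFrustratedLawGap` — an everywhere-positive re-rooting weight

Route `FrustratedLawDichotomy`, crux `AperiodicFrustratedLawGap` (item `stmt-AtomisticToContinuum-27623`),
registered stub `stub_ergodicReduction` (skeleton `dd3251ad731e`); third brick of step D5 (`hErg`), companion
of `…ErgodicLazyOperator`: the lazy re-rooting operator `(P f)(S) = Σ_{y∈S} w(y) f(S−y) + (1 − Σ_{y∈S} w(y)) f(S)`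
needs a measurable EVEN weight `w` which is POSITIVE AND FINITE EVERYWHERE (so that every point of the
configuration is reached — the fixed space of `P` is then exactly the re-rooting-invariant functions) and has
mass `Σ_{y∈S} w(y) ≤ 1` on EVERY rooted `δ`-hard-core configuration.  Here: `w(0) = 1/2`,
`w(y) = (δ⁵/500) ‖y‖⁻⁵` for `y ≠ 0`, using the shell bound `Σ_{y ∈ S∖{0}} ‖y‖⁻⁵ ≤ 250 δ⁻⁵`
(`BenjaminiSchrammLimit.Finset.sum_norm_inv_pow_five_le`).

* `exists_rerootWeight` — existence of such a weight (`δ > 0`).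

`[folklore]`.
-/

noncomputable section

namespace Summit.AtomisticToContinuum.Crystallization.Theorems.FrustratedLawDichotomyErgodicReduction

open MeasureTheory Set Filter
open scoped ENNReal Classical
open Literature.Probability.Process (LocalConfig)
open Literature.Probability.Process.LocalConfig (RootedHardCoreConfig toMeasure_def)
open Summit.AtomisticToContinuum.Crystallization.Theorems.BenjaminiSchrammLimit (norm_ge_of_mem
  lintegral_toMeasure_le_of_forall_finset)

variable {δ : ℝ}

/-- **An everywhere-positive even re-rooting weight of mass `≤ 1`.**  For `δ > 0` there is a measurable
weight `w : ℝ³ → ℝ≥0∞`, even, with `0 < w(y) < ∞` for every `y`, such that `Σ_{y ∈ S} w(y) ≤ 1` for every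
rooted `δ`-hard-core configuration `S` of `ℝ³`: take `w(0) = 1/2` and `w(y) = (δ⁵/500) ‖y‖⁻⁵` otherwise; the
points of `S ∖ {0}` are `δ`-separated and at distance `≥ δ` from the root, so `Σ ‖y‖⁻⁵ ≤ 250 δ⁻⁵`. [folklore] -/
theorem exists_rerootWeight (hδ : 0 < δ) :
    ∃ w : EuclideanSpace ℝ (Fin 3) → ℝ≥0∞, Measurable w ∧ (∀ y, w (-y) = w y) ∧ (∀ y, w y ≠ 0) ∧
      (∀ y, w y ≠ ∞) ∧ ∀ S : RootedHardCoreConfig (EuclideanSpace ℝ (Fin 3)) δ,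
        ∫⁻ y, w y ∂((S.1 : LocalConfig (EuclideanSpace ℝ (Fin 3))).toMeasure) ≤ 1 := by
  set c : ℝ := δ ^ 5 / 500 with hc_def
  have hc : 0 < c := by positivity
  set w : EuclideanSpace ℝ (Fin 3) → ℝ≥0∞ :=
    fun y => if y = 0 then 2⁻¹ else ENNReal.ofReal (c * ‖y‖⁻¹ ^ 5) with hw_def
  have hw0 : w 0 = 2⁻¹ := by simp [hw_def]
  have hwy : ∀ y, y ≠ 0 → w y = ENNReal.ofReal (c * ‖y‖⁻¹ ^ 5) := fun y hy => by simp [hw_def, hy]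
  refine ⟨w, ?_, ?_, ?_, ?_, ?_⟩
  · exact Measurable.ite (measurableSet_singleton 0) measurable_const
      (ENNReal.measurable_ofReal.comp (((measurable_norm.inv).pow_const 5).const_mul c))
  · intro y
    by_cases hy : y = 0
    · rw [hy, neg_zero]
    · rw [hwy y hy, hwy (-y) (neg_ne_zero.2 hy), norm_neg]
  · intro y
    by_cases hy : y = 0
    · rw [hy, hw0]; simp
    · rw [hwy y hy]
      have : 0 < c * ‖y‖⁻¹ ^ 5 := by
        have : 0 < ‖y‖ := norm_pos_iff.2 hy
        positivity
      exact (ENNReal.ofReal_pos.2 this).ne'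
  · intro y
    by_cases hy : y = 0
    · rw [hy, hw0]; simp
    · rw [hwy y hy]; exact ENNReal.ofReal_ne_top
  · intro S
    refine lintegral_toMeasure_le_of_forall_finset hδ S fun T hT => ?_
    -- the points other than the root
    have hT' : ∀ y ∈ T.erase 0,
        y ∈ ((S.1 : LocalConfig (EuclideanSpace ℝ (Fin 3))) : Set (EuclideanSpace ℝ (Fin 3))) ∧ y ≠ 0 :=
      fun y hy => ⟨hT (Finset.mem_of_mem_erase hy), Finset.ne_of_mem_erase hy⟩
    have hrest : ∑ y ∈ T.erase 0, w y ≤ 2⁻¹ := by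
      calc ∑ y ∈ T.erase 0, w y = ∑ y ∈ T.erase 0, ENNReal.ofReal (c * ‖y‖⁻¹ ^ 5) :=
            Finset.sum_congr rfl fun y hy => hwy y (hT' y hy).2
        _ = ENNReal.ofReal (∑ y ∈ T.erase 0, c * ‖y‖⁻¹ ^ 5) :=
            (ENNReal.ofReal_sum_of_nonneg fun y _ => by positivity).symm
        _ = ENNReal.ofReal (c * ∑ y ∈ T.erase 0, ‖y‖⁻¹ ^ 5) := by rw [Finset.mul_sum]
        _ ≤ ENNReal.ofReal (c * (250 * δ⁻¹ ^ 5)) := by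
            refine ENNReal.ofReal_le_ofReal (mul_le_mul_of_nonneg_left ?_ hc.le)
            exact Summit.AtomisticToContinuum.Crystallization.Theorems.BenjaminiSchrammLimit.Finset.sum_norm_inv_pow_five_le
              _ hδ
              (fun y hy y' hy' hne => S.2.2 y (hT' y hy).1 y' (hT' y' hy').1 hne)
              fun y hy => norm_ge_of_mem S (hT' y hy).1 (hT' y hy).2
        _ = 2⁻¹ := by
            have h : c * (250 * δ⁻¹ ^ 5) = (2 : ℝ)⁻¹ := by
              rw [hc_def]
              field_simp
              ring
            rw [h, ENNReal.ofReal_inv_of_pos two_pos, ENNReal.ofReal_ofNat]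
    by_cases h0 : (0 : EuclideanSpace ℝ (Fin 3)) ∈ T
    · rw [← Finset.add_sum_erase T w h0, hw0]
      calc (2 : ℝ≥0∞)⁻¹ + ∑ y ∈ T.erase 0, w y ≤ 2⁻¹ + 2⁻¹ := add_le_add le_rfl hrest
        _ = 1 := ENNReal.inv_two_add_inv_two
    · rw [← Finset.erase_eq_of_notMem h0]
      exact hrest.trans (by norm_num)

end Summit.AtomisticToContinuum.Crystallization.Theorems.FrustratedLawDichotomyErgodicReduction

end
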